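import Summits.Ventures.LatticeQCDFlow.TrivializingMaps.WilsonLinkLocality
import Literature.MathematicalPhysics.QuantumFieldTheory.AbelianVortexClustering

/-!
HONEST FRAMING: exact (Metropolis-corrected) sampling algorithms for lattice gauge theory; figures
of merit are autocorrelation/cost numbers at stated couplings and volumes; no continuum-physics
claim.

# WilsonNonInteractingLinks — AN EXTENSIVE SET OF LINKS NO TWO OF WHICH SHARE A PLAQUETTE (`⌊L/2⌋^d`
# DIRECTION-`i₀` LINKS ON THE EVEN SUBLATTICE), THE BLOCK OF LINKS SEEN BY `S_e`, AND THE OSCILLATION OF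
# `S_W` UNDER A CHANGE OF THE LINKS OF A BLOCK (lean-2 GEN-9, ours)

Venture-side (OURS).  Cell `lqcd-flow` (pub-lqcd), unit `pub-lqcd-lean-2-g9`, 2026-08-22.  The
combinatorial inputs of the `β ≠ 0` extensive variance floor (`WilsonVarianceFloorAllCouplings`):

* §1 `evenSite x = 2x` (coordinatewise, `x : Fin d → Fin ⌊L/2⌋`), `evenLinks i₀` (the links `(2x, i₀)`):
  `evenSite_injective`, **`card_evenLinks`** (`= ⌊L/2⌋^d`), `evenSite_ne_shift` (`2x' ≠ 2x + m̂`: parity,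
  no wrap-around since `2x_m + 1 < L`), `mem_plaqLinks_cases`, **`evenLinks_pairwise`** (no plaquette
  contains two different links of `evenLinks i₀`).
* §2 `plaqRe_congr` (a plaquette term depends only on its four links), `linkBlock e =
  ⋃_{p ∋ e} plaqLinks p`, **`linkAction_congr_block`**, `card_linkBlock_le` (`≤ 4(d+1)d²`),
  **`wilsonAction_piecewise_sub_le`** (replacing the links of a finite set `Λ` changes `S_W` by at most
  `2N · #(⋃_{e∈Λ} plaqThrough e) ≤ 2N · #Λ · (d+1)d²`).

NOT CLAIMED: optimality (`⌊L/2⌋^d` of the `d·L^d` links; the sharp block has `6(d−1)+1` links);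
anything probabilistic.  Literature grade (cell rule): bookkeeping; new typing only.
-/

noncomputable section

open MeasureTheory ProbabilityTheory Filter Topology Set
open Literature.MathematicalPhysics.QuantumFieldTheory
open Literature.MathematicalPhysics.QuantumFieldTheory.Luscher2010

namespace Summit.Ventures.LatticeQCDFlow.TrivializingMaps

variable {d L N : ℕ} [NeZero L] {G : Type*} [Group G]

/-! ## §1 The even sublattice of direction-`i₀` links -/

section Even

/-- The site `2x` of the torus (coordinatewise, `x_m < ⌊L/2⌋`, so `2x_m ≤ L − 2`: no wrap-around).
[ours] -/
def evenSite (x : Fin d → Fin (L / 2)) : Site d L := fun m => ((2 * (x m : ℕ) : ℕ) : ZMod L)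

/-- The direction-`i₀` links based on the even sublattice. [ours] -/
def evenLinks (i₀ : Fin d) : Finset (Edge d L) :=
  Finset.univ.image fun x : Fin d → Fin (L / 2) => ((evenSite x : Site d L), i₀)

omit [NeZero L] in
/-- `2·x_m < L` for `x_m < ⌊L/2⌋`, and `2·x_m + 1 < L`. [folklore] -/
theorem two_mul_fin_half_lt (a : Fin (L / 2)) : 2 * (a : ℕ) + 1 < L := by
  have := a.2
  omega

omit [NeZero L] in
/-- Casting `n < L` to `ZMod L` is injective: `(a : ZMod L) = b → a = b` for `a, b < L`. [folklore] -/
theorem natCast_zmod_inj {a b : ℕ} (ha : a < L) (hb : b < L) (h : ((a : ℕ) : ZMod L) = (b : ℕ)) : a = b := by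
  have h' := (ZMod.natCast_eq_natCast_iff' a b L).1 h
  rwa [Nat.mod_eq_of_lt ha, Nat.mod_eq_of_lt hb] at h'

omit [NeZero L] in
/-- `x ↦ 2x` is injective. [ours] -/
theorem evenSite_injective : Function.Injective (evenSite : (Fin d → Fin (L / 2)) → Site d L) := by
  intro x x' h
  funext m
  have hm := congrFun h m
  simp only [evenSite] at hm
  have := natCast_zmod_inj (L := L) (by have := two_mul_fin_half_lt (L := L) (x m); omega)
    (by have := two_mul_fin_half_lt (L := L) (x' m); omega) hm
  exact Fin.ext (by omega)

omit [NeZero L] in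
/-- **`#evenLinks i₀ = ⌊L/2⌋^d`.** [ours] -/
theorem card_evenLinks (i₀ : Fin d) : (evenLinks (L := L) i₀).card = (L / 2) ^ d := by
  unfold evenLinks
  rw [Finset.card_image_of_injective _ (fun x x' h => evenSite_injective (Prod.mk.inj h).1),
    Finset.card_univ, Fintype.card_fun, Fintype.card_fin, Fintype.card_fin]

omit [NeZero L] in
/-- **Parity: `2x' ≠ 2x + m̂`** (no wrap-around since `2x_m + 1 < L`). [ours] -/
theorem evenSite_ne_shift (x x' : Fin d → Fin (L / 2)) (m : Fin d) :
    (evenSite x' : Site d L) ≠ (evenSite x).shift m := by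
  intro h
  have hm := congrFun h m
  simp only [evenSite, Site.shift, Pi.add_apply, Pi.single_eq_same] at hm
  rw [show ((2 * (x m : ℕ) : ℕ) : ZMod L) + 1 = ((2 * (x m : ℕ) + 1 : ℕ) : ZMod L) by push_cast; ring] at hm
  have := natCast_zmod_inj (L := L) (by have := two_mul_fin_half_lt (L := L) (x' m); omega)
    (two_mul_fin_half_lt (L := L) (x m)) hm
  omega

omit [NeZero L] in
/-- A link of the plaquette `(z, k, l)` is either a `k`-link at `z` or `z + l̂`, or an `l`-link at `z` or
`z + k̂`. [folklore] -/
theorem mem_plaqLinks_cases {p : Plaquette d L} {a : Edge d L} (ha : a ∈ plaqLinks p) :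
    (a.2 = p.2.1.1 ∧ (a.1 = p.1 ∨ a.1 = p.1.shift p.2.1.2)) ∨
      (a.2 = p.2.1.2 ∧ (a.1 = p.1 ∨ a.1 = p.1.shift p.2.1.1)) := by
  rw [mem_plaqLinks_iff] at ha
  rcases ha with rfl | rfl | rfl | rfl
  · exact Or.inl ⟨rfl, Or.inl rfl⟩
  · exact Or.inr ⟨rfl, Or.inr rfl⟩
  · exact Or.inl ⟨rfl, Or.inr rfl⟩
  · exact Or.inr ⟨rfl, Or.inl rfl⟩

omit [NeZero L] in
/-- Two different even sites are never `{z, z + m̂}` in either order, nor equal. [ours] -/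
theorem evenSite_pair_cases {x x' : Fin d → Fin (L / 2)} (hxx' : x ≠ x') {z : Site d L} {m : Fin d}
    (hx : evenSite x = z ∨ evenSite x = z.shift m) (hx' : evenSite x' = z ∨ evenSite x' = z.shift m) : False := by
  rcases hx with hx | hx <;> rcases hx' with hx' | hx'
  · exact hxx' (evenSite_injective (hx.trans hx'.symm))
  · exact evenSite_ne_shift x x' m (by rw [hx', hx])
  · exact evenSite_ne_shift x' x m (by rw [hx, hx'])
  · exact hxx' (evenSite_injective (hx.trans hx'.symm))

omit [NeZero L] in
/-- **No plaquette contains two different links of `evenLinks i₀`.** [ours] -/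
theorem evenLinks_pairwise (i₀ : Fin d) {a a' : Edge d L} (ha : a ∈ evenLinks (L := L) i₀)
    (ha' : a' ∈ evenLinks (L := L) i₀) (hne : a ≠ a') (p : Plaquette d L) :
    a ∈ plaqLinks p → a' ∉ plaqLinks p := by
  intro hap ha'p
  simp only [evenLinks, Finset.mem_image, Finset.mem_univ, true_and] at ha ha'
  obtain ⟨x, rfl⟩ := ha
  obtain ⟨x', rfl⟩ := ha'
  have hxx' : x ≠ x' := fun h => hne (by rw [h])
  have hkl : p.2.1.1 ≠ p.2.1.2 := ne_of_lt p.2.2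
  rcases mem_plaqLinks_cases hap with ⟨h1, h2⟩ | ⟨h1, h2⟩ <;>
    rcases mem_plaqLinks_cases ha'p with ⟨h1', h2'⟩ | ⟨h1', h2'⟩
  · exact evenSite_pair_cases hxx' h2 h2'
  · exact hkl (h1.symm.trans h1')
  · exact hkl (h1'.symm.trans h1)
  · exact evenSite_pair_cases hxx' h2 h2'

omit [NeZero L] in
/-- **Every link lies in at least one plaquette** (`d ≥ 2`). [folklore] -/
theorem one_le_card_plaqThrough [NeZero L] (hd : 2 ≤ d) (e : Edge d L) : 1 ≤ (plaqThrough e).card := by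
  rw [Nat.one_le_iff_ne_zero, Ne, Finset.card_eq_zero, ← Ne, ← Finset.nonempty_iff_ne_empty]
  obtain ⟨y, i⟩ := e
  by_cases hi : (i : ℕ) + 1 < d
  · refine ⟨(y, ⟨(i, ⟨i + 1, hi⟩), by simp [Fin.lt_def]⟩), ?_⟩
    rw [mem_plaqThrough_iff, mem_plaqLinks_iff]
    exact Or.inl rfl
  · have hj : (i : ℕ) - 1 < d := by omega
    refine ⟨(y, ⟨(⟨i - 1, hj⟩, i), by simp [Fin.lt_def]; omega⟩), ?_⟩
    rw [mem_plaqThrough_iff, mem_plaqLinks_iff]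
    exact Or.inr (Or.inr (Or.inr rfl))

-- `#plaquettes ≤ d² · L^d` is the Literature's `LatticeForm.card_plaquette_le` (`AbelianVortexClustering`).

omit [NeZero L] in
/-- `L^d ≤ 3^d · ⌊L/2⌋^d` for `L ≥ 2`. [folklore] -/
theorem pow_le_three_pow_mul_half_pow (hL : 2 ≤ L) : L ^ d ≤ 3 ^ d * (L / 2) ^ d := by
  rw [← mul_pow]
  exact Nat.pow_le_pow_left (by omega) d


end Even

/-! ## §2 Locality of the plaquette terms; the block of `S_e`; oscillation under a block change -/

section Block

variable (ρ : G →* Matrix (Fin N) (Fin N) ℂ)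

omit [NeZero L] in
/-- **A plaquette term depends only on its four links.** [folklore] -/
theorem plaqRe_congr {p : Plaquette d L} {U V : GaugeConfig d L G} (h : ∀ e ∈ plaqLinks p, U e = V e) :
    WilsonRP.plaqRe ρ U p = WilsonRP.plaqRe ρ V p := by
  unfold WilsonRP.plaqRe plaquetteHolonomy
  rw [h _ (by simp [plaqLinks]), h (p.1.shift p.2.1.1, p.2.1.2) (by simp [plaqLinks]),
    h (p.1.shift p.2.1.2, p.2.1.1) (by simp [plaqLinks]), h (p.1, p.2.1.2) (by simp [plaqLinks])]

/-- The block of links seen by `S_e`: the links of the plaquettes through `e`. [ours] -/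
def linkBlock (e : Edge d L) : Finset (Edge d L) := (plaqThrough e).biUnion plaqLinks

/-- **`S_e` depends only on the links of its block.** [ours] -/
theorem linkAction_congr_block {e : Edge d L} {U V : GaugeConfig d L G}
    (h : ∀ e' ∈ linkBlock e, U e' = V e') : linkAction ρ e U = linkAction ρ e V := by
  unfold linkAction
  refine Finset.sum_congr rfl fun p hp => ?_
  rw [plaqRe_congr ρ (fun e' he' => h e' (Finset.mem_biUnion.2 ⟨p, hp, he'⟩))]

omit [NeZero L] in
/-- A plaquette has at most four links. [folklore] -/
theorem card_plaqLinks_le (p : Plaquette d L) : (plaqLinks p).card ≤ 4 := by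
  unfold plaqLinks
  refine (Finset.card_insert_le _ _).trans ?_
  refine (Nat.add_le_add_right (Finset.card_insert_le _ _) 1).trans ?_
  refine (Nat.add_le_add_right (Nat.add_le_add_right (Finset.card_insert_le _ _) 1) 1).trans ?_
  rw [Finset.card_singleton]

/-- **`#linkBlock e ≤ 4(d+1)d²`.** [ours] -/
theorem card_linkBlock_le (e : Edge d L) : (linkBlock e).card ≤ 4 * ((d + 1) * d ^ 2) := by
  unfold linkBlock
  calc ((plaqThrough e).biUnion plaqLinks).card ≤ ∑ p ∈ plaqThrough e, (plaqLinks p).card :=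
        Finset.card_biUnion_le
    _ ≤ ∑ _p ∈ plaqThrough e, 4 := Finset.sum_le_sum fun p _ => card_plaqLinks_le p
    _ = 4 * (plaqThrough e).card := by rw [Finset.sum_const, smul_eq_mul, mul_comm]
    _ ≤ 4 * ((d + 1) * d ^ 2) := Nat.mul_le_mul_left 4 (card_plaqThrough_le e)

/-- The plaquettes meeting a finite set of links `Λ` number at most `#Λ · (d+1)d²`. [ours] -/
theorem card_biUnion_plaqThrough_le (Λ : Finset (Edge d L)) :
    (Λ.biUnion plaqThrough).card ≤ Λ.card * ((d + 1) * d ^ 2) := by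
  calc (Λ.biUnion plaqThrough).card ≤ ∑ e ∈ Λ, (plaqThrough e).card := Finset.card_biUnion_le
    _ ≤ ∑ _e ∈ Λ, ((d + 1) * d ^ 2) := Finset.sum_le_sum fun e _ => card_plaqThrough_le e
    _ = Λ.card * ((d + 1) * d ^ 2) := by rw [Finset.sum_const, smul_eq_mul]

variable [TopologicalSpace G] [IsTopologicalGroup G] [CompactSpace G]

/-- **Replacing the links of `Λ` changes `S_W` by at most `2N · #(⋃_{e∈Λ} plaqThrough e)`**:
`S_W((Λ.piecewise k 1)·U) − S_W((Λ.piecewise k' 1)·U) ≤ 2N · #(Λ.biUnion plaqThrough)` (plaquettes not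
meeting `Λ` contribute equally; each other plaquette term lies in `[0, 2N]`). [ours] -/
theorem wilsonAction_piecewise_sub_le (hρ : Continuous ρ) (Λ : Finset (Edge d L))
    (k k' U : GaugeConfig d L G) :
    wilsonAction ρ (Λ.piecewise k 1 * U) - wilsonAction ρ (Λ.piecewise k' 1 * U) ≤
      2 * N * (Λ.biUnion plaqThrough).card := by
  classical
  set T := Λ.biUnion plaqThrough with hT
  have hS : ∀ W : GaugeConfig d L G, wilsonAction ρ W =
      ∑ p ∈ Finset.univ.filter (fun p : Plaquette d L => p ∈ T), ((N : ℝ) - WilsonRP.plaqRe ρ W p) +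
      ∑ p ∈ Finset.univ.filter (fun p : Plaquette d L => p ∉ T), ((N : ℝ) - WilsonRP.plaqRe ρ W p) := by
    intro W
    have h : wilsonAction ρ W = ∑ p : Plaquette d L, ((N : ℝ) - WilsonRP.plaqRe ρ W p) := rfl
    rw [h]
    exact (Finset.sum_filter_add_sum_filter_not Finset.univ (fun p : Plaquette d L => p ∈ T)
      (fun p => (N : ℝ) - WilsonRP.plaqRe ρ W p)).symm
  -- plaquettes not meeting `Λ` see the same links in both configurations
  have hagree : ∀ p : Plaquette d L, p ∉ T →
      WilsonRP.plaqRe ρ (Λ.piecewise k 1 * U) p = WilsonRP.plaqRe ρ (Λ.piecewise k' 1 * U) p := by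
    intro p hp
    refine plaqRe_congr ρ fun e' he' => ?_
    have he'Λ : e' ∉ Λ := fun h => hp (Finset.mem_biUnion.2 ⟨e', h, (mem_plaqThrough_iff e' p).2 he'⟩)
    simp only [Pi.mul_apply, Finset.piecewise_eq_of_notMem _ _ _ he'Λ]
  have hout : ∑ p ∈ Finset.univ.filter (fun p : Plaquette d L => p ∉ T),
      ((N : ℝ) - WilsonRP.plaqRe ρ (Λ.piecewise k 1 * U) p) =
      ∑ p ∈ Finset.univ.filter (fun p : Plaquette d L => p ∉ T),
      ((N : ℝ) - WilsonRP.plaqRe ρ (Λ.piecewise k' 1 * U) p) :=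
    Finset.sum_congr rfl fun p hp => by rw [hagree p (Finset.mem_filter.1 hp).2]
  -- each plaquette term lies in `[0, 2N]`
  have hterm : ∀ (W : GaugeConfig d L G) (p : Plaquette d L),
      0 ≤ (N : ℝ) - WilsonRP.plaqRe ρ W p ∧ (N : ℝ) - WilsonRP.plaqRe ρ W p ≤ 2 * N := fun W p => by
    have h := abs_le.1 (WilsonRP.abs_plaqRe_le ρ hρ W p)
    constructor <;> linarith [h.1, h.2]
  have hin : ∑ p ∈ Finset.univ.filter (fun p : Plaquette d L => p ∈ T),
      ((N : ℝ) - WilsonRP.plaqRe ρ (Λ.piecewise k 1 * U) p) -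
      ∑ p ∈ Finset.univ.filter (fun p : Plaquette d L => p ∈ T),
      ((N : ℝ) - WilsonRP.plaqRe ρ (Λ.piecewise k' 1 * U) p) ≤ 2 * N * T.card := by
    have hfilter : Finset.univ.filter (fun p : Plaquette d L => p ∈ T) = T := by
      ext p; simp
    rw [hfilter, ← Finset.sum_sub_distrib]
    calc ∑ p ∈ T, (((N : ℝ) - WilsonRP.plaqRe ρ (Λ.piecewise k 1 * U) p) -
          ((N : ℝ) - WilsonRP.plaqRe ρ (Λ.piecewise k' 1 * U) p)) ≤ ∑ _p ∈ T, (2 * (N : ℝ)) :=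
          Finset.sum_le_sum fun p _ => by
            have h1 := (hterm (Λ.piecewise k 1 * U) p).2
            have h2 := (hterm (Λ.piecewise k' 1 * U) p).1
            linarith
      _ = 2 * N * T.card := by rw [Finset.sum_const, nsmul_eq_mul]; ring
  rw [hS (Λ.piecewise k 1 * U), hS (Λ.piecewise k' 1 * U), hout]
  linarith

/-- **Replacing the links of `Λ` changes `S_W` by at most `2N · #Λ · (d+1)d²`.** [ours] -/
theorem wilsonAction_piecewise_sub_le' (hρ : Continuous ρ) (Λ : Finset (Edge d L))
    (k k' U : GaugeConfig d L G) :
    wilsonAction ρ (Λ.piecewise k 1 * U) - wilsonAction ρ (Λ.piecewise k' 1 * U) ≤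
      2 * N * (Λ.card * ((d + 1) * d ^ 2) : ℕ) := by
  refine (wilsonAction_piecewise_sub_le ρ hρ Λ k k' U).trans ?_
  have h := card_biUnion_plaqThrough_le (d := d) (L := L) Λ
  have h0 : (0 : ℝ) ≤ 2 * N := by positivity
  exact mul_le_mul_of_nonneg_left (by exact_mod_cast h) h0

end Block

end Summit.Ventures.LatticeQCDFlow.TrivializingMaps
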